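import Literature.AnabelianGeometry.SemiGraphs.ProSigmaCompletionMalnormal
import Literature.AnabelianGeometry.SemiGraphs.ProSigmaCompletionModels
import Literature.AnabelianGeometry.SemiGraphs.OncePuncturedTemperedGroupWitness
import Literature.AnabelianGeometry.AbsoluteAnabelian.ZHatCompletionAdicCompleteness
import HarnessLib

/-!
# An INFINITE estranged family of procyclic subgroups of `F̂₂`: the closures `C_k` of `⟨a b^k⟩`, `k ∈ ℤ`
# ([SemiAnbd] Ex. 2.10 p. 31 «totally estranged»; Def. 2.4 (iv) p. 26)

Mochizuki, *Semi-graphs of anabelioids*, Publ. RIMS **42** (2006) [SemiAnbd], Def. 2.4 (iv) p. 26 (estranged: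
`Π_b ∩ g Π_{b'} g⁻¹ = 1` for `b' ≠ b`, or `b' = b` and `g ∉ Π_b`) and Example 2.10 p. 31 (the cusps of a
pointed stable curve give totally estranged open edges; print cites [AbsAnab] Lem. 1.3.7)
[cite: MochizukiSemiAnbd2006, Ex. 2.10 p.31].

Group-theory brick (abc-iut cell, layer L3, seat abc-iut-L3-t11 gen 6, step (B3) of the row «NV-hLG@cusped» /
«CUSP-ABS·NONDEGENERATE-NV»): the fibres of a cusped Example 3.10 tower over the `F̂₂` datum of
`TemperedCuspidalAbsolutenessLeafCuspedNonVacuity.lean` are one-vertex semi-graphs of anabelioids with MANY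
cusps (`OneVertexCuspsHypotheses.lean`), which need arbitrarily large ESTRANGED families of infinite closed
subgroups of `F̂₂`.  With `η : F₂ → F̂₂` the profinite completion of the free group on `a = x₀`, `b = x₁`:

* `TwistedCusps.twist k : F₂ ≃* F₂` — the Nielsen automorphism `a ↦ a b^k`, `b ↦ b`, and
  `twistBasis k` — the free basis `{a b^k, b}`; `cusp k := closure η⟨a b^k⟩ ≤ F̂₂`;
* `cusp_inf_conj_self_eq_bot` — **malnormality**: `C_k ∩ x C_k x⁻¹ = 1` for `x ∉ C_k` — abc-iut-L5-d2 /
  w5-d051's engine `IsProSigmaCompletion.closure_zpowers_inf_conj_eq_bot` BY NAME at the basis `twistBasis k`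
  (`η` is a pro-`{all primes}` completion: `isProSigmaCompletion_toCompletion`);
* `cusp_inf_conj_eq_bot_of_ne` — **pairwise estrangement**: `C_k ∩ g C_j g⁻¹ = 1` for `k ≠ j` and EVERY `g`
  (the completed exponent sums `ê_a`, `ê_b : F̂₂ → Ẑ` kill conjugation as `Ẑ` is commutative; on
  `C_k = î_k(Ẑ)` they read `t ↦ t` and `t ↦ t^k`; so a common element has `t^k = t^j`, and `Ẑ ≅ ∏_p ℤ_p` is
  torsion-free, `zHat_eq_one_of_zpow_eq_one`);
* `cusp_estranged` — both in the `map (MulAut.conj g)` currency of `OneVertexCusps.thm37Hypotheses`' `hest`.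

Classical profinite group theory (special cases of the malnormality of free factors, Herfort–Ribes); nothing of
[SemiAnbd] is asserted; no instance, no notation, no `Prop` fact.  Nothing here bears on [IUTchIII] Cor. 3.12.
-/

noncomputable section

open Topology Filter Set Function
open scoped Pointwise
open Literature.IUT.HodgeTheaters (profiniteCompletion toCompletion toCompletion_int_injective)
open Literature.AnabelianGeometry.AbsoluteAnabelian

namespace Literature.AnabelianGeometry.SemiGraphs

namespace TwistedCusps

open SemiGraphOfAnabelioids.IsProSigmaCompletion

/-! ## 1. The Nielsen twists and the twisted bases of `F₂` -/

/-- The word `a b^k ∈ F₂` (`a = x₀`, `b = x₁`). [cite: MochizukiSemiAnbd2006, Ex. 2.10 p.31] -/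
def word (k : ℤ) : FreeGroup (Fin 2) := FreeGroup.of 0 * FreeGroup.of 1 ^ k

/-- The endomorphism `a ↦ a b^k`, `b ↦ b` of `F₂`. [cite: MochizukiSemiAnbd2006, Ex. 2.10 p.31] -/
def twistHom (k : ℤ) : FreeGroup (Fin 2) →* FreeGroup (Fin 2) :=
  FreeGroup.lift fun i => if i = 0 then word k else FreeGroup.of 1

/-- `twistHom k` on the generators. [cite: MochizukiSemiAnbd2006, Ex. 2.10 p.31] -/
@[simp] theorem twistHom_of_zero (k : ℤ) : twistHom k (FreeGroup.of 0) = word k := by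
  simp [twistHom]

/-- `twistHom k` on the generators. [cite: MochizukiSemiAnbd2006, Ex. 2.10 p.31] -/
@[simp] theorem twistHom_of_one (k : ℤ) : twistHom k (FreeGroup.of 1) = FreeGroup.of 1 := by
  simp [twistHom]

/-- `twistHom (-k)` inverts `twistHom k`. [cite: MochizukiSemiAnbd2006, Ex. 2.10 p.31] -/
theorem twistHom_comp_neg (k : ℤ) : (twistHom (-k)).comp (twistHom k) = MonoidHom.id _ := by
  ext i
  fin_cases i
  · simp only [MonoidHom.comp_apply, MonoidHom.id_apply]
    rw [show ((⟨0, by norm_num⟩ : Fin 2)) = 0 from rfl, twistHom_of_zero, word, map_mul, map_zpow,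
      twistHom_of_zero, twistHom_of_one, word, mul_assoc, ← zpow_add, neg_add_cancel, zpow_zero, mul_one]
  · simp only [MonoidHom.comp_apply, MonoidHom.id_apply]
    rw [show ((⟨1, by norm_num⟩ : Fin 2)) = 1 from rfl, twistHom_of_one, twistHom_of_one]

/-- **The Nielsen twist** `a ↦ a b^k`, `b ↦ b` as an automorphism of `F₂`.
[cite: MochizukiSemiAnbd2006, Ex. 2.10 p.31] -/
def twist (k : ℤ) : FreeGroup (Fin 2) ≃* FreeGroup (Fin 2) :=
  MonoidHom.toMulEquiv (twistHom k) (twistHom (-k)) (twistHom_comp_neg k)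
    (by simpa using twistHom_comp_neg (-k))

/-- `twist k (a) = a b^k`. [cite: MochizukiSemiAnbd2006, Ex. 2.10 p.31] -/
@[simp] theorem twist_of_zero (k : ℤ) : twist k (FreeGroup.of 0) = word k := twistHom_of_zero k

/-- **The twisted free basis `{a b^k, b}` of `F₂`.** [cite: MochizukiSemiAnbd2006, Ex. 2.10 p.31] -/
def twistBasis (k : ℤ) : FreeGroupBasis (Fin 2) (FreeGroup (Fin 2)) :=
  (FreeGroupBasis.ofFreeGroup (Fin 2)).map (twist k)

/-- The first element of the twisted basis is `a b^k`. [cite: MochizukiSemiAnbd2006, Ex. 2.10 p.31] -/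
@[simp] theorem twistBasis_zero (k : ℤ) : twistBasis k 0 = word k := by
  simp [twistBasis]

/-! ## 2. The cusp subgroups `C_k = closure η⟨a b^k⟩ ≤ F̂₂` and their malnormality -/

/-- `C_k := closure η⟨a b^k⟩`, a closed procyclic subgroup of `F̂₂`. [cite: MochizukiSemiAnbd2006, Ex. 2.10 p.31] -/
def cusp (k : ℤ) : Subgroup (profiniteCompletion (FreeGroup (Fin 2))) :=
  (Subgroup.zpowers (toCompletion (FreeGroup (Fin 2)) (word k))).topologicalClosure

/-- `C_k` is closed. [cite: MochizukiSemiAnbd2006, Ex. 2.10 p.31] -/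
theorem isClosed_cusp (k : ℤ) : IsClosed (cusp k : Set (profiniteCompletion (FreeGroup (Fin 2)))) :=
  Subgroup.isClosed_topologicalClosure _

/-- **MALNORMALITY of `C_k`**: `C_k ∩ x C_k x⁻¹ = 1` for every `x ∉ C_k` — the tree's pro-`Σ` malnormality
engine at the twisted basis `{a b^k, b}`. [cite: MochizukiSemiAnbd2006, Ex. 2.10 p.31] -/
theorem cusp_inf_conj_self_eq_bot (k : ℤ) {x : profiniteCompletion (FreeGroup (Fin 2))} (hx : x ∉ cusp k) :
    cusp k ⊓ ConjAct.toConjAct x • cusp k = ⊥ := by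
  have h := closure_zpowers_inf_conj_eq_bot (twistBasis k) 0
    (isProSigmaCompletion_toCompletion (FreeGroup (Fin 2))) (x := x) (by rwa [twistBasis_zero])
  rwa [twistBasis_zero] at h

/-! ## 3. Completed exponent sums and the parametrisations `î_k : Ẑ → C_k` -/

/-- The exponent sum of `a` (`a ↦ 1`, `b ↦ 0`). [cite: MochizukiSemiAnbd2006, Ex. 2.10 p.31] -/
def sigmaA : FreeGroup (Fin 2) →* Multiplicative ℤ :=
  FreeGroup.lift fun i => if i = 0 then Multiplicative.ofAdd (1 : ℤ) else 1

/-- The exponent sum of `b` (`a ↦ 0`, `b ↦ 1`). [cite: MochizukiSemiAnbd2006, Ex. 2.10 p.31] -/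
def sigmaB : FreeGroup (Fin 2) →* Multiplicative ℤ :=
  FreeGroup.lift fun i => if i = 0 then 1 else Multiplicative.ofAdd (1 : ℤ)

/-- `σ_a(a b^k) = 1`. [cite: MochizukiSemiAnbd2006, Ex. 2.10 p.31] -/
theorem sigmaA_word (k : ℤ) : sigmaA (word k) = Multiplicative.ofAdd 1 := by
  simp [sigmaA, word]

/-- `σ_b(a b^k) = k`. [cite: MochizukiSemiAnbd2006, Ex. 2.10 p.31] -/
theorem sigmaB_word (k : ℤ) : sigmaB (word k) = Multiplicative.ofAdd k := by
  simp [sigmaB, word, ← ofAdd_zsmul]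

/-- The completed exponent sum `ê : F̂₂ → Ẑ` of `σ`. [cite: MochizukiSemiAnbd2006, Ex. 2.10 p.31] -/
def hatOf (σ : FreeGroup (Fin 2) →* Multiplicative ℤ) :
    profiniteCompletion (FreeGroup (Fin 2)) →ₜ* profiniteCompletion (Multiplicative ℤ) :=
  (ProfiniteGrp.ProfiniteCompletion.lift (GrpCat.ofHom ((toCompletion (Multiplicative ℤ)).comp σ))).hom

/-- `ê ∘ η = ι ∘ σ`. [cite: MochizukiSemiAnbd2006, Ex. 2.10 p.31] -/
theorem hatOf_eta (σ : FreeGroup (Fin 2) →* Multiplicative ℤ) (g : FreeGroup (Fin 2)) :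
    hatOf σ (toCompletion _ g) = toCompletion (Multiplicative ℤ) (σ g) :=
  lift_hom_toCompletion _ ((toCompletion (Multiplicative ℤ)).comp σ) g

/-- The parametrisation `î_k : Ẑ → F̂₂` completing `n ↦ (a b^k)^n`. [cite: MochizukiSemiAnbd2006, Ex. 2.10 p.31] -/
def hatPow (k : ℤ) : profiniteCompletion (Multiplicative ℤ) →ₜ* profiniteCompletion (FreeGroup (Fin 2)) :=
  (ProfiniteGrp.ProfiniteCompletion.lift
    (GrpCat.ofHom ((toCompletion (FreeGroup (Fin 2))).comp (zpowersHom _ (word k))))).hom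

/-- `î_k (ι n) = η((a b^k)^n)`. [cite: MochizukiSemiAnbd2006, Ex. 2.10 p.31] -/
theorem hatPow_iota (k n : ℤ) :
    hatPow k (toCompletion (Multiplicative ℤ) (Multiplicative.ofAdd n)) = toCompletion _ (word k ^ n) := by
  unfold hatPow
  rw [lift_hom_toCompletion _ ((toCompletion (FreeGroup (Fin 2))).comp (zpowersHom _ (word k)))]
  simp [zpowersHom_apply]

/-- `ê ∘ î = (· ^ m)` when `σ(a b^k) = m`: continuous homomorphisms agreeing on the dense image of `ℤ`.
[cite: MochizukiSemiAnbd2006, Ex. 2.10 p.31] -/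
theorem hatOf_hatPow (σ : FreeGroup (Fin 2) →* Multiplicative ℤ) (k m : ℤ) (hσ : σ (word k) = Multiplicative.ofAdd m)
    (t : profiniteCompletion (Multiplicative ℤ)) : hatOf σ (hatPow k t) = t ^ m := by
  have hd : DenseRange (toCompletion (Multiplicative ℤ)) :=
    ProfiniteGrp.ProfiniteCompletion.denseRange (GrpCat.of (Multiplicative ℤ))
  have key : (fun t => hatOf σ (hatPow k t)) = fun t => t ^ m := by
    refine hd.equalizer ((map_continuous (hatOf σ)).comp (map_continuous (hatPow k))) (continuous_zpow m) ?_
    funext n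
    simp only [Function.comp_apply]
    have hn : n = Multiplicative.ofAdd n.toAdd := rfl
    rw [hn, hatPow_iota, hatOf_eta, map_zpow, hσ,
      ← map_zpow (toCompletion (Multiplicative ℤ)) (Multiplicative.ofAdd (Multiplicative.toAdd n)) m,
      ← ofAdd_zsmul, ← ofAdd_zsmul, smul_eq_mul, smul_eq_mul, mul_comm]
  exact congrFun key t

/-- `ê_a ∘ î_k = id`. [cite: MochizukiSemiAnbd2006, Ex. 2.10 p.31] -/
theorem hatA_hatPow (k : ℤ) (t : profiniteCompletion (Multiplicative ℤ)) : hatOf sigmaA (hatPow k t) = t := by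
  rw [hatOf_hatPow sigmaA k 1 (sigmaA_word k), zpow_one]

/-- `ê_b ∘ î_k = (· ^ k)`. [cite: MochizukiSemiAnbd2006, Ex. 2.10 p.31] -/
theorem hatB_hatPow (k : ℤ) (t : profiniteCompletion (Multiplicative ℤ)) : hatOf sigmaB (hatPow k t) = t ^ k :=
  hatOf_hatPow sigmaB k k (sigmaB_word k) t

/-- Every element of `C_k` is an `î_k(t)` (the range of `î_k` is compact, hence closed, and contains `η⟨a b^k⟩`).
[cite: MochizukiSemiAnbd2006, Ex. 2.10 p.31] -/
theorem exists_hatPow_eq_of_mem_cusp (k : ℤ) {z : profiniteCompletion (FreeGroup (Fin 2))} (hz : z ∈ cusp k) :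
    ∃ t, hatPow k t = z := by
  have hsub := TemperedFibreProduct.closure_eta_zpowers_subset_range (word k) (hatPow k) (hatPow_iota k)
  have hz' : z ∈ closure (toCompletion (FreeGroup (Fin 2)) '' (Subgroup.zpowers (word k) : Set _)) := by
    have : (cusp k : Set (profiniteCompletion (FreeGroup (Fin 2)))) =
        closure (toCompletion (FreeGroup (Fin 2)) '' (Subgroup.zpowers (word k) : Set _)) := by
      rw [cusp, Subgroup.topologicalClosure_coe, ← MonoidHom.map_zpowers, Subgroup.coe_map]
    rw [← this]; exact hz
  exact hsub hz'

/-! ## 4. `Ẑ` is torsion-free; pairwise estrangement of the `C_k` -/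

/-- **`Ẑ` is torsion-free**: `t^n = 1`, `n ≠ 0` force `t = 1` (through `Ẑ ≃ₜ* ∏_p ℤ_p`, each `ℤ_p` being a
domain of characteristic `0`). [cite: RibesZalesskii2010, Thm 2.7.1] -/
theorem zHat_eq_one_of_zpow_eq_one {t : profiniteCompletion (Multiplicative ℤ)} {n : ℤ} (hn : n ≠ 0)
    (h : t ^ n = 1) : t = 1 := by
  obtain ⟨e, -⟩ := ZHatCompletion.exists_continuousMulEquiv_padicProd
  have h1 : Multiplicative.toAdd (e t) = 0 := by
    funext q
    haveI : Fact (Nat.Prime (q : ℕ)) := ⟨q.2⟩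
    have hq : n • Multiplicative.toAdd (e t) q = 0 := by
      have := congrArg (fun x => Multiplicative.toAdd (e x) q) h
      simpa using this
    rw [zsmul_eq_mul, mul_eq_zero] at hq
    rcases hq with hq | hq
    · exact absurd (by exact_mod_cast hq) hn
    · exact hq
  apply e.injective
  rw [map_one]
  exact toAdd_eq_zero.mp h1

/-- `Ẑ` is commutative (bookkeeping: conjugation is trivial in `Ẑ`). [cite: RibesZalesskii2010, Thm 2.7.1] -/
theorem zHat_conj_eq (u v : profiniteCompletion (Multiplicative ℤ)) : u * v * u⁻¹ = v := by
  rw [ZHatCompletion.mul_comm u v, mul_inv_cancel_right]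

/-- **PAIRWISE ESTRANGEMENT**: for `k ≠ j` and EVERY `g ∈ F̂₂`, `C_k ∩ g C_j g⁻¹ = 1`.
[cite: MochizukiSemiAnbd2006, Ex. 2.10 p.31] -/
theorem cusp_inf_conj_eq_bot_of_ne {k j : ℤ} (hkj : k ≠ j) (g : profiniteCompletion (FreeGroup (Fin 2))) :
    cusp k ⊓ ConjAct.toConjAct g • cusp j = ⊥ := by
  rw [eq_bot_iff]
  rintro z ⟨hzk, hzj⟩
  rw [Subgroup.mem_bot]
  obtain ⟨y, hy, hgy⟩ := (Subgroup.mem_smul_pointwise_iff_exists _ _ _).mp hzj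
  rw [ConjAct.toConjAct_smul] at hgy
  obtain ⟨t, rfl⟩ := exists_hatPow_eq_of_mem_cusp k hzk
  obtain ⟨s, rfl⟩ := exists_hatPow_eq_of_mem_cusp j hy
  -- `ê_a`: `t = s`
  have ha : t = s := by
    have := congrArg (hatOf sigmaA) hgy
    rw [map_mul, map_mul, map_inv, zHat_conj_eq, hatA_hatPow, hatA_hatPow] at this
    exact this.symm
  subst ha
  -- `ê_b`: `t^k = t^j`, so `t^(k-j) = 1`, so `t = 1`
  have hb : t ^ k = t ^ j := by
    have := congrArg (hatOf sigmaB) hgy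
    rw [map_mul, map_mul, map_inv, zHat_conj_eq, hatB_hatPow, hatB_hatPow] at this
    exact this.symm
  have ht : t = 1 := by
    refine zHat_eq_one_of_zpow_eq_one (sub_ne_zero.mpr hkj) ?_
    rw [zpow_sub, hb, mul_inv_cancel]
  rw [ht, map_one]

/-! ## 5. The estrangement law in the `MulAut.conj` currency -/

/-- `ConjAct.toConjAct g • H = H.map (conj g)` (bookkeeping between the two conjugation currencies of the tree).
[cite: MochizukiSemiAnbd2006, Def 2.4(iv) p.26] -/
theorem conjAct_smul_eq_map_conj {G : Type*} [Group G] (g : G) (H : Subgroup G) :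
    ConjAct.toConjAct g • H = H.map (MulAut.conj g).toMonoidHom := by
  ext x
  rw [Subgroup.mem_smul_pointwise_iff_exists, Subgroup.mem_map]
  constructor
  · rintro ⟨y, hy, rfl⟩
    exact ⟨y, hy, by rw [ConjAct.toConjAct_smul]; rfl⟩
  · rintro ⟨y, hy, rfl⟩
    exact ⟨y, hy, by rw [ConjAct.toConjAct_smul]; rfl⟩

/-- **THE ESTRANGEMENT LAW of the family `(C_k)_{k ∈ ℤ}`** in the shape of the hypothesis `hest` of
`OneVertexCusps.thm37Hypotheses`: `C_k ∩ g C_j g⁻¹ = 1` whenever `j ≠ k` or `g ∉ C_k`.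
[cite: MochizukiSemiAnbd2006, Def 2.4(iv) p.26] -/
theorem cusp_estranged (k j : ℤ) (g : profiniteCompletion (FreeGroup (Fin 2))) (h : j ≠ k ∨ g ∉ cusp k) :
    cusp k ⊓ (cusp j).map (MulAut.conj g).toMonoidHom = ⊥ := by
  rw [← conjAct_smul_eq_map_conj]
  rcases h with hjk | hg
  · exact cusp_inf_conj_eq_bot_of_ne (Ne.symm hjk) g
  · by_cases hjk : k = j
    · subst hjk; exact cusp_inf_conj_self_eq_bot k hg
    · exact cusp_inf_conj_eq_bot_of_ne hjk g

/-- Along an injective index map `c : ι → ℤ` the family `(C_{c k})` still satisfies the estrangement law.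
[cite: MochizukiSemiAnbd2006, Def 2.4(iv) p.26] -/
theorem cusp_estranged_of_injective {ι : Type*} (c : ι → ℤ) (hc : Function.Injective c) (k k' : ι)
    (g : profiniteCompletion (FreeGroup (Fin 2))) (h : k' ≠ k ∨ g ∉ cusp (c k)) :
    cusp (c k) ⊓ (cusp (c k')).map (MulAut.conj g).toMonoidHom = ⊥ :=
  cusp_estranged (c k) (c k') g (h.imp (fun hne heq => hne (hc heq)) id)

/-- The `C_k` are infinite (they contain `î_k(Ẑ) ∋ η((a b^k)^n)` for all `n`, and `η` is injective on the
infinite cyclic group `⟨a b^k⟩`, `a b^k ≠ 1`). [cite: MochizukiSemiAnbd2006, Def 2.4(iv) p.26] -/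
theorem infinite_cusp (k : ℤ) : Infinite (cusp k) := by
  have hinj : Function.Injective fun n : ℤ =>
      (⟨toCompletion (FreeGroup (Fin 2)) (word k ^ n), Subgroup.le_topologicalClosure _
        (Subgroup.mem_zpowers_iff.mpr ⟨n, by rw [map_zpow]⟩)⟩ : cusp k) := by
    intro m n hmn
    have h1 : toCompletion (FreeGroup (Fin 2)) (word k ^ m) = toCompletion (FreeGroup (Fin 2)) (word k ^ n) :=
      congrArg Subtype.val hmn
    have h2 := congrArg (hatOf sigmaA) h1
    simp only [hatOf_eta, map_zpow, sigmaA_word] at h2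
    rw [← map_zpow (toCompletion (Multiplicative ℤ)) (Multiplicative.ofAdd (1 : ℤ)) m,
      ← map_zpow (toCompletion (Multiplicative ℤ)) (Multiplicative.ofAdd (1 : ℤ)) n,
      ← ofAdd_zsmul, ← ofAdd_zsmul, smul_eq_mul, smul_eq_mul, mul_one, mul_one] at h2
    exact Multiplicative.ofAdd.injective (toCompletion_int_injective h2)
  exact Infinite.of_injective _ hinj

end TwistedCusps

end Literature.AnabelianGeometry.SemiGraphs

end
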